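import Literature.NumberTheory.Automorphic.IdeleClassBaseChangeNorm
import Literature.NumberTheory.Automorphic.IdeleClassBaseChangeInjective
import Literature.NumberTheory.Automorphic.IdeleClassIntegration
import Mathlib.Topology.Maps.Proper.CompactlyGenerated
import HarnessLib

/-!
# The base change `C_K → C_L` of idèle class groups is a proper map

Topic `NumberTheory/Automorphic`; namespace `Literature.NumberTheory.Automorphic`. Everything here is proved.

For a finite extension of number fields `L/K` and `ι = classBaseChange K L : C_K →* C_L`:

* `isCompact_norm_preimage_of_isCompact` — **norm shells of `C_K` are compact**: for a compact `S ⊆ ℝ≥0` not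
  containing `0`, `{c ∈ C_K : ‖c‖ ∈ S}` is compact (it is closed and contained in the image in `C_K` of the compact
  set `P_{[a,b]} · W` of `IdeleClassIntegration.lean`: every idèle with `log |x| ∈ [a, b]` is `k · y`, `k ∈ Kˣ`,
  `y ∈ P_{[a,b]} · W` — `logNorm_preimage_Icc_subset_iUnion_smul`, Tate's "`J¹/kˣ` is compact");
* `isProperMap_classBaseChange` — **`ι` is a proper map** ("injects continuously and PROPERLY", PerL v5 §3.2
  l. 310): for compact `T ⊆ C_L`, `ι⁻¹(T)` is closed and contained in the norm shell
  `{‖c‖_K ^ [L:K] ∈ ‖T‖_L}` (`norm_classBaseChange`), hence compact; `C_L` is Hausdorff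
  (`IdeleClassGroup.t2Space_ideleClassGroup_holds`) and locally compact, so `isProperMap_iff_isCompact_preimage`
  applies;
* `isClosedEmbedding_classBaseChange` — for `L/K` Galois (injectivity, `classBaseChange_injective`), `ι` is a
  closed embedding.

Provenance: tree-vocabulary form of `NumberField.isProperMap_classBaseChange` / `isClosedEmbedding_classBaseChange` of
the `pub-hodgecm` package (`HodgeCM/Literature/ClassBaseChange.lean` gen 5 + `ClassBaseChangeInjective.lean`, over pv10's
`ProperBaseChange` / `ProperCriterion`), here from the norm-shell compactness of the tree.

## References

* J. W. S. Cassels, A. Fröhlich (eds.), *Algebraic Number Theory* (1967), Ch. II §16; Ch. XV (Tate) Thm. 4.3.2.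
  [CasselsFrohlichANT1967]
-/

noncomputable section

open NumberField Set
open scoped NNReal Pointwise

namespace Literature.NumberTheory.Automorphic

variable (K L : Type) [Field K] [Field L] [Algebra K L] [NumberField K] [NumberField L]

/-- **Norm shells of `C_K` are compact**: for `S ⊆ ℝ≥0` compact with `0 ∉ S`, `‖·‖⁻¹(S) ⊆ C_K` is compact.
[cite: CasselsFrohlichANT1967, Ch. XV Thm. 4.3.2] -/
theorem isCompact_norm_preimage_of_isCompact {S : Set ℝ≥0} (hS : IsCompact S) (h0 : (0 : ℝ≥0) ∉ S) :
    IsCompact ((IdeleClassGroup.norm K) ⁻¹' S) := by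
  haveI : T2Space (IdeleClassGroup K) := IdeleClassGroup.t2Space_ideleClassGroup_holds K
  -- `S ⊆ [m, M]` with `0 < m`
  by_cases hne : S.Nonempty
  swap
  · rw [Set.not_nonempty_iff_eq_empty.mp hne, Set.preimage_empty]; exact isCompact_empty
  obtain ⟨m, hmS, hm⟩ := hS.exists_isMinOn hne (continuous_id.continuousOn)
  obtain ⟨M, hMS, hM⟩ := hS.exists_isMaxOn hne (continuous_id.continuousOn)
  have hm0 : 0 < (m : ℝ) := by
    have : m ≠ 0 := fun h => h0 (h ▸ hmS)
    exact NNReal.coe_pos.2 (pos_iff_ne_zero.2 this)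
  set a : ℝ := Real.log m with ha
  set b : ℝ := Real.log M with hb
  -- the shell is contained in the image of the compact `P_{[a,b]} · W`
  have hsub : (IdeleClassGroup.norm K) ⁻¹' S ⊆
      (QuotientGroup.mk : GaloisRepresentations.ideleGroup K → IdeleClassGroup K) '' shellCover K a b := by
    intro c hc
    induction c using QuotientGroup.induction_on with
    | H x =>
      rw [Set.mem_preimage, IdeleClassGroup.norm_mk] at hc
      have hx : logNorm K x ∈ Icc a b := by
        have h1 : (m : ℝ) ≤ IdeleClassGroup.ideleNorm K x := by exact_mod_cast hm hc
        have h2 : (IdeleClassGroup.ideleNorm K x : ℝ) ≤ M := by exact_mod_cast hM hc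
        exact ⟨(Real.log_le_log_iff hm0 (ideleNorm_real_pos x)).2 h1,
          (Real.log_le_log_iff (ideleNorm_real_pos x) (hm0.trans_le (h1.trans h2))).2 h2⟩
      obtain ⟨k, hk⟩ := Set.mem_iUnion.1 (logNorm_preimage_Icc_subset_iUnion_smul K a b hx)
      obtain ⟨y, hy, rfl⟩ := Set.mem_smul_set.1 hk
      refine ⟨y, hy, ?_⟩
      rw [Subgroup.smul_def, smul_eq_mul, QuotientGroup.mk_mul,
        (QuotientGroup.eq_one_iff (k : GaloisRepresentations.ideleGroup K)).mpr k.2]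
      exact (one_mul (y : IdeleClassGroup K)).symm
  have hclosed : IsClosed ((IdeleClassGroup.norm K) ⁻¹' S) := hS.isClosed.preimage (continuous_classNorm K)
  exact ((isCompact_shellCover K a b).image QuotientGroup.continuous_mk).of_isClosed_subset hclosed hsub

/-- **`ι : C_K → C_L` is a proper map.** [cite: CasselsFrohlichANT1967, Ch. II §16] -/
theorem isProperMap_classBaseChange : IsProperMap (classBaseChange K L) := by
  haveI : T2Space (IdeleClassGroup L) := IdeleClassGroup.t2Space_ideleClassGroup_holds L
  haveI := locallyCompactSpace_ideleGroup L
  haveI : LocallyCompactSpace (IdeleClassGroup L) := inferInstance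
  rw [isProperMap_iff_isCompact_preimage]
  refine ⟨continuous_classBaseChange K L, fun T hT => ?_⟩
  -- `ι⁻¹(T) ⊆ {c : ‖c‖ ^ [L:K] ∈ ‖T‖}` — a compact norm shell
  set S : Set ℝ≥0 := (fun r : ℝ≥0 => r ^ Module.finrank K L) ⁻¹' ((IdeleClassGroup.norm L) '' T) with hSdef
  have hn : Module.finrank K L ≠ 0 := Module.finrank_pos.ne'
  have hST : IsCompact ((IdeleClassGroup.norm L) '' T) := hT.image (continuous_classNorm L)
  have hS : IsCompact S := by
    -- the preimage of a compact set under `r ↦ r ^ n` (`n ≠ 0`) is closed and bounded in `ℝ≥0`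
    obtain ⟨M, hM⟩ := hST.bddAbove
    have hbdd : S ⊆ Set.Icc 0 (max M 1) := by
      intro r hr
      refine ⟨bot_le, ?_⟩
      have hle : r ^ Module.finrank K L ≤ M := hM hr
      by_contra hlt
      rw [not_le] at hlt
      have h1 : 1 < r := lt_of_le_of_lt (le_max_right M 1) hlt
      have h2 : r ≤ r ^ Module.finrank K L := le_self_pow₀ h1.le hn
      exact absurd ((le_max_left M 1).trans_lt (hlt.trans_le h2)) (not_lt.2 hle)
    exact (isCompact_Icc.of_isClosed_subset (hST.isClosed.preimage (continuous_pow _)) hbdd)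
  have h0 : (0 : ℝ≥0) ∉ S := by
    intro h
    rw [hSdef, Set.mem_preimage, zero_pow hn] at h
    obtain ⟨c, -, hc⟩ := h
    induction c using QuotientGroup.induction_on with
    | H x => rw [IdeleClassGroup.norm_mk] at hc; exact ideleNorm_ne_zero x hc
  have hsub : (classBaseChange K L) ⁻¹' T ⊆ (IdeleClassGroup.norm K) ⁻¹' S := by
    intro c hc
    rw [Set.mem_preimage, hSdef, Set.mem_preimage, ← norm_classBaseChange]
    exact ⟨_, hc, rfl⟩
  exact (isCompact_norm_preimage_of_isCompact K hS h0).of_isClosed_subset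
    (hT.isClosed.preimage (continuous_classBaseChange K L)) hsub

/-- **`ι` is a closed embedding for `L/K` Galois** ("injects continuously and properly", PerL v5 l. 310).
[cite: CasselsFrohlichANT1967, Ch. II §16] -/
theorem isClosedEmbedding_classBaseChange [IsGalois K L] : Topology.IsClosedEmbedding (classBaseChange K L) :=
  .of_continuous_injective_isClosedMap (continuous_classBaseChange K L) (classBaseChange_injective K L)
    (isProperMap_classBaseChange K L).isClosedMap

end Literature.NumberTheory.Automorphic

end
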